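import Mathlib
import Literature.AlgebraicGeometry.Resolution.AbhyankarEtaleAscent
import Summits.ResolutionOfSingularities.ResolutionOfSingularities.Theorems.RadicialJungCleanModelsKK05Thm34Gen
import Summits.ResolutionOfSingularities.ResolutionOfSingularities.Theorems.RadicialJungCleanModelsKK05Thm41Pos
import Summits.ResolutionOfSingularities.ResolutionOfSingularities.Theorems.RadicialJungCleanModelsKK05ToricCentre
import Summits.ResolutionOfSingularities.ResolutionOfSingularities.Theorems.RadicialJungCleanModelsKK05UnramifiedParameters
import Summits.ResolutionOfSingularities.ResolutionOfSingularities.Theorems.RadicialJungCleanModelsKK05EtaleModel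
import HarnessLib

/-!
# Knaf–Kuhlmann 2005, Thm. 1.1 WITH the «Moreover» (monomial) clause — the model (ambient-field form), WITH the value-independence of the parameters

Route `RadicialJung`, crux `CleanModels` (stmt-ResolutionOfSingularities-15917); seat `decomp-res-hand-1` g4.  = ✓ `KK05ValueBasis.monomial_model` (hand-1 g3)
RE-RUN VERBATIM with ONE more conjunct exported: the values `v(x'₁), …, v(x'_ρ)` of the Perron parameters are `ℤ`-independent modulo `vK` (clause `hx'i` of
✓ `thm41_field_pos`, discarded by the g3 statement) — the input of the dimension count at a NON-closed centre (`ρ ≤ rr v ≤ dim A − dim A/𝔭 = ht 𝔭`) in the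
discharge of the GENERAL form `KnafKuhlmann2005_Thm11_monomialFormSepGen` of Knaf–Kuhlmann's Thm. 1.1 with monomial clause (g3's statement served zero-dimensional
places only).  Proof text = g3's (Knaf–Kuhlmann p. 13 with the monomial bookkeeping: ✓ `thm34_henselRoot_gen`, ✓ `thm41_field_pos`, ✓ `exists_standardEtale_model_unramified`).
* `monomial_model_indep`.  OURS (assembly of landed pieces; mathematics = Knaf–Kuhlmann 2005 §§4–5); proves nothing about resolution in characteristic `p`. counted 0.
-/

noncomputable section

set_option linter.dupNamespace false -- mandated namespace of this single-conjunct summit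

open IsLocalRing Polynomial
open Literature.AlgebraicGeometry.Resolution

namespace Summit.ResolutionOfSingularities.ResolutionOfSingularities.Theorems.RadicialJung.CleanModels

namespace KK05ValueBasis

universe u

variable {Ω : Type u} [Field Ω]

set_option maxHeartbeats 1600000 in -- one long assembly proof over deep towers `K → K[x',y] → B → C → A`
set_option synthInstance.maxHeartbeats 400000 in -- idem (scalar towers `K → C → A`)
/-- **Knaf–Kuhlmann 2005, Thm. 1.1 with the bookkeeping of its monomial clause (ambient form), exporting the value-independence of the
parameters.**  For `F|K` finitely generated inside `Ω`, `K ⊆ 𝒪_V`, `V` an Abhyankar place of `F|K` with `FP|KP` separably generated, and a finite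
`Z ⊆ 𝒪_V ∩ F`: there is a finitely generated `K`-subalgebra `A ⊆ 𝒪_V ∩ F` with `Frac A = F` and `Z ⊆ A`, elements `x'₁,…,x'_ρ ∈ A` algebraically
independent over `K` whose VALUES are `ℤ`-linearly independent modulo `vK` (`∏ⱼ v(x'ⱼ)^{mⱼ} ∈ vK ⇒ m = 0`), such that every non-zero `ζ ∈ Z` is
`u · ∏ x'ⱼ^{cⱼ}` with `u ∈ A`, `v u = 1`, `c ∈ ℕ^ρ`, and every `a ∈ A` with `v a < 1` satisfies `t a = Σ cⱼ x'ⱼ` for some `t ∈ A` with `v t = 1` and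
`cⱼ ∈ A` (the centre of `V` on `A` is generated by the `x'ⱼ` locally).  Same proof as ✓ `monomial_model`, one more conjunct kept.
[cite: KnafKuhlmann2005, Thm. 1.1 and its proof (p. 13), Lemma 4.2, Thm. 4.1, Lemma 5.1] -/
theorem monomial_model_indep (V : ValuationSubring Ω) (K F : Subfield Ω) (hfg : FGOver K F)
    (hKV : (K : Set Ω) ⊆ V) (hA : IsAbhyankarPlace V K F)
    (hsep : SeparablyGeneratedOver (resField V K) (resField V F))
    (Z : Finset Ω) (hZ : ∀ z ∈ Z, z ∈ V ∧ z ∈ F) :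
    ∃ (A : Subalgebra K Ω) (_ : A.toSubring ≤ V.toSubring), (A : Set Ω) ⊆ F ∧ A.FG ∧
      (∀ w ∈ F, ∃ a ∈ A, ∃ b ∈ A, w = a / b) ∧ (∀ z ∈ Z, z ∈ A) ∧
      ∃ (ρ : ℕ) (x' : Fin ρ → Ω), (∀ j, x' j ∈ A ∧ x' j ≠ 0 ∧ V.valuation (x' j) < 1) ∧
        AlgebraicIndependent K x' ∧
        (∀ m : Fin ρ → ℤ, (∃ b ∈ K, (∏ j, V.valuation (x' j) ^ (m j)) = V.valuation b) → m = 0) ∧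
        (∀ z ∈ Z, z ≠ 0 → ∃ (c : Fin ρ → ℕ) (u : Ω), u ∈ A ∧ V.valuation u = 1 ∧ z = u * ∏ j, x' j ^ (c j)) ∧
        (∀ a ∈ A, V.valuation a < 1 → ∃ t ∈ A, V.valuation t = 1 ∧
          ∃ c : Fin ρ → Ω, (∀ j, c j ∈ A) ∧ t * a = ∑ j, c j * x' j) := by
  classical
  obtain ⟨ρ, τ, x, y, hy, hxF, hyF, hxi, hgenv, hri, η, hηV, f0, hEηF, hf0mon, hf0coef, hf0η, hf0der⟩ :=
    thm34_henselRoot_gen V K F hfg hKV hA hsep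
  set E : Subfield Ω := Subfield.closure ((K : Set Ω) ∪ (Set.range x ∪ Set.range y)) with hE
  obtain ⟨f, g, h, p₂, s, hfmon, hfη, hcoef, hfmin, hident, hvg, hOF⟩ :=
    exists_standardEtale_data_of_henselRoot V E F hηV hEηF f0 hf0mon hf0coef hf0η hf0der
  have hx0 : ∀ i, x i ≠ 0 := fun i => (hxF i).2
  have hKV' : ∀ c ∈ K, c ∈ V := fun c hc => hKV hc
  have hKE : K ≤ E := fun c hc => Subfield.subset_closure (Or.inl hc)
  have hEF : E ≤ F := by rw [← hEηF]; exact fun w hw => Subfield.subset_closure (Or.inl hw)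
  have hηF : η ∈ F := by rw [← hEηF]; exact Subfield.subset_closure (Or.inr rfl)
  have hexp : ∀ z : Ω, ∃ m : Fin ρ → ℤ, V.valuation (∏ i, x i ^ (m i)) ≤ 1 ∧
      (z ∈ F → z ∈ V → z ≠ 0 → V.valuation z = V.valuation (∏ i, x i ^ (m i))) := by
    intro z
    by_cases hz : z ∈ F ∧ z ∈ V ∧ z ≠ 0
    · obtain ⟨m, hm⟩ := hgenv z hz.1 hz.2.2
      have hzm : V.valuation z = V.valuation (∏ i, x i ^ (m i)) := by rw [hm, valuation_prod_zpow]
      exact ⟨m, hzm ▸ (V.valuation_le_one_iff z).mpr hz.2.1, fun _ _ _ => hzm⟩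
    · refine ⟨0, by simp, fun h1 h2 h3 => (hz ⟨h1, h2, h3⟩).elim⟩
  choose mz hmz1 hmz using hexp
  let mono : (Fin ρ → ℤ) → Ω := fun m => ∏ i, x i ^ (m i)
  have hmono0 : ∀ m, mono m ≠ 0 := fun m => prod_zpow_ne_zero x hx0 m
  have hmonoF : ∀ m, mono m ∈ F := fun m => prod_zpow_mem x (fun i => (hxF i).1) m
  let uz : Ω → Ω := fun z => z / mono (mz z)
  have huz : ∀ z ∈ Z, z ≠ 0 → V.valuation (uz z) = 1 ∧ uz z ∈ V ∧ uz z ∈ F ∧ (uz z)⁻¹ ∈ V ∧ (uz z)⁻¹ ∈ F := by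
    intro z hz hz0
    have hv : V.valuation (uz z) = 1 := by
      simp only [uz]
      rw [map_div₀, ← hmz z (hZ z hz).2 (hZ z hz).1 hz0, div_self ((map_ne_zero V.valuation).mpr hz0)]
    have hF : uz z ∈ F := div_mem (hZ z hz).2 (hmonoF _)
    exact ⟨hv, (V.valuation_le_one_iff _).mp hv.le, hF, (V.valuation_le_one_iff _).mp (by rw [map_inv₀, hv, inv_one]), inv_mem hF⟩
  have hrep : ∀ z : Z, ∃ (a b a' b' : Polynomial Ω) (k k' : ℕ), (z : Ω) ≠ 0 →
      ((∀ P ∈ ({a, b, a', b'} : Set (Polynomial Ω)), ∀ k, P.coeff k ∈ V ∧ P.coeff k ∈ E) ∧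
        V.valuation (b.eval η) = 1 ∧ uz z = a.eval η / (b.eval η * g.eval η ^ k) ∧
        V.valuation (b'.eval η) = 1 ∧ (uz z)⁻¹ = a'.eval η / (b'.eval η * g.eval η ^ k')) := by
    intro z
    by_cases hz0 : (z : Ω) = 0
    · exact ⟨0, 0, 0, 0, 0, 0, fun h => (h hz0).elim⟩
    obtain ⟨hv, huV, huF, huiV, huiF⟩ := huz z z.2 hz0
    obtain ⟨a, b, k, hab, hvb, heq⟩ := hOF _ huF huV
    obtain ⟨a', b', k', hab', hvb', heq'⟩ := hOF _ huiF huiV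
    refine ⟨a, b, a', b', k, k', fun _ => ⟨?_, hvb, heq, hvb', heq'⟩⟩
    rintro P hP
    simp only [Set.mem_insert_iff, Set.mem_singleton_iff] at hP
    rcases hP with rfl | rfl | rfl | rfl
    exacts [hab _ (by simp), hab _ (by simp), hab' _ (by simp), hab' _ (by simp)]
  choose az bz az' bz' kz kz' hrepz using hrep
  let Z'' : Finset Ω := (f.coeffs ∪ g.coeffs ∪ h.coeffs ∪ p₂.coeffs) ∪
    (Finset.univ.filter fun z : Z => (z : Ω) ≠ 0).biUnion
      fun z => (az z).coeffs ∪ (bz z).coeffs ∪ (az' z).coeffs ∪ (bz' z).coeffs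
  have hcoeffs : ∀ P : Polynomial Ω, (∀ k, P.coeff k ∈ V ∧ P.coeff k ∈ E) → ∀ w ∈ P.coeffs, w ∈ V ∧ w ∈ E := by
    intro P hP w hw; obtain ⟨k, -, rfl⟩ := Polynomial.mem_coeffs_iff.mp hw; exact hP k
  have hZ'' : ∀ w ∈ Z'', w ∈ V ∧ w ∈ E := by
    intro w hw
    simp only [Z'', Finset.mem_union, Finset.mem_biUnion, Finset.mem_filter, Finset.mem_univ, true_and] at hw
    rcases hw with (((hw | hw) | hw) | hw) | ⟨z, hz0, ((hw | hw) | hw) | hw⟩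
    exacts [hcoeffs f (hcoef f (by simp)) w hw, hcoeffs g (hcoef g (by simp)) w hw, hcoeffs h (hcoef h (by simp)) w hw,
      hcoeffs p₂ (hcoef p₂ (by simp)) w hw, hcoeffs _ ((hrepz z hz0).1 _ (by simp)) w hw,
      hcoeffs _ ((hrepz z hz0).1 _ (by simp)) w hw, hcoeffs _ ((hrepz z hz0).1 _ (by simp)) w hw,
      hcoeffs _ ((hrepz z hz0).1 _ (by simp)) w hw]
  let Dx : Finset (Fin ρ → ℤ) := Z.image mz
  have hDx : ∀ m ∈ Dx, (∏ i, V.valuation (x i) ^ (m i)) ≤ 1 := fun m hm => by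
    obtain ⟨z, -, rfl⟩ := Finset.mem_image.mp hm; rw [← valuation_prod_zpow]; exact hmz1 z
  obtain ⟨x', hDxmono, hx', hxx', hx'i, hind, hZ''A⟩ :=
    thm41_field_pos V K hKV' x y hx0 hxi hy hri Z'' hZ'' Dx hDx
  have hx'0 : ∀ j, x' j ≠ 0 := fun j => (hx' j).2.1
  have hx'1 : ∀ j, V.valuation (x' j) < 1 := fun j => (hx' j).2.2
  set A₀ : Subalgebra K Ω := Algebra.adjoin K (Set.range x' ∪ Set.range y) with hA₀
  let VK : Subalgebra K Ω := { V.toSubring with algebraMap_mem' := fun c => hKV' c c.2 }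
  have hA₀V : A₀.toSubring ≤ V.toSubring := fun w hw => (show A₀ ≤ VK from Algebra.adjoin_le (by
    rintro w (⟨j, rfl⟩ | ⟨j, rfl⟩); exacts [(V.valuation_le_one_iff _).mp (hx'1 j).le, hy j])) hw
  let EK : Subalgebra K Ω := { E.toSubring with algebraMap_mem' := fun c => hKE c.2 }
  have hA₀E : (A₀ : Set Ω) ⊆ E := fun w hw => (show A₀ ≤ EK from Algebra.adjoin_le (by
    rintro w (⟨j, rfl⟩ | ⟨j, rfl⟩); exacts [(hx' j).1, Subfield.subset_closure (Or.inr (Or.inr ⟨j, rfl⟩))])) hw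
  have hrange : Set.range (Sum.elim x' y) = Set.range x' ∪ Set.range y := Set.Sum.elim_range _ _
  let e₀ : MvPolynomial (Fin ρ ⊕ Fin τ) K ≃ₐ[K] A₀ :=
    hind.aevalEquiv.trans (Subalgebra.equivOfEq _ _ (by rw [hA₀, ← hrange]))
  haveI : Algebra.FinitePresentation K A₀ := Algebra.FinitePresentation.equiv e₀
  haveI : Algebra.FormallySmooth K A₀ := Algebra.FormallySmooth.of_equiv e₀
  haveI : IsIntegrallyClosed A₀ := by
    haveI : UniqueFactorizationMonoid A₀ := (e₀.toMulEquiv).uniqueFactorizationMonoid inferInstance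
    exact UniqueFactorizationMonoid.instIsIntegrallyClosed
  have hA₀cl : A₀.toSubring = Subring.closure ((K : Set Ω) ∪ (Set.range x' ∪ Set.range y)) := by
    have hKr : Set.range (algebraMap K Ω) = (K : Set Ω) :=
      Set.ext fun w => ⟨fun ⟨c, hc⟩ => hc ▸ c.2, fun hw => ⟨⟨w, hw⟩, rfl⟩⟩
    rw [hA₀, Algebra.adjoin_eq_ring_closure, hKr]
  choose num hnum den hden hvden hweq using hZ''A
  let d : Ω := ∏ w ∈ Z''.attach, den w w.2
  have hdA : d ∈ A₀ := prod_mem fun w _ => hden w w.2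
  have hvd : V.valuation d = 1 := by simp only [d, map_prod]; exact Finset.prod_eq_one fun w _ => hvden w w.2
  have hd0 : d ≠ 0 := fun h0 => by rw [h0, map_zero] at hvd; exact zero_ne_one hvd
  let B : Subalgebra K Ω := locAway A₀ d hdA
  have hA₀B : A₀ ≤ B := le_locAway
  have hZ''B : ∀ w ∈ Z'', w ∈ B := by
    intro w hw
    have hden0 : den w hw ≠ 0 := fun h0 => by
      have := hvden w hw; rw [h0, map_zero] at this; exact zero_ne_one this
    have hsplit : d = den w hw * ∏ w' ∈ (Z''.attach.erase ⟨w, hw⟩), den w' w'.2 :=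
      (Finset.mul_prod_erase Z''.attach (fun w' : {w' // w' ∈ Z''} => den w' w'.2)
        (Finset.mem_attach _ ⟨w, hw⟩)).symm
    have hwden : w * den w hw = num w hw := (eq_div_iff hden0).mp (hweq w hw)
    refine ⟨1, ?_⟩
    rw [pow_one, hsplit, ← mul_assoc, hwden]
    exact mul_mem (hnum w hw) (prod_mem fun w' _ => hden w' w'.2)
  letI algB : Algebra A₀ B := (Subalgebra.inclusion hA₀B).toRingHom.toAlgebra
  haveI : IsScalarTower K A₀ B := IsScalarTower.of_algebraMap_eq fun _ => rfl
  haveI hloc : IsLocalization.Away (⟨d, hdA⟩ : A₀) B := isLocalization_locAway hd0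
  haveI : Algebra.Smooth K A₀ := {}
  haveI hBsm : Algebra.Smooth K B := by
    haveI : Algebra.Smooth A₀ B := Algebra.Smooth.of_isLocalization_Away (⟨d, hdA⟩ : A₀)
    exact Algebra.Smooth.comp K A₀ B
  haveI hBic : IsIntegrallyClosed B :=
    isIntegrallyClosed_of_isLocalization B (Submonoid.powers (⟨d, hdA⟩ : A₀))
      (powers_le_nonZeroDivisors_of_noZeroDivisors fun h0 => hd0 (congrArg Subtype.val h0))
  have hBV : B.toSubring ≤ V.toSubring := locAway_le_valuationSubring hA₀V hvd
  have hBE : (B : Set Ω) ⊆ E := locAway_subset_subfield hA₀E hd0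
  have hBF : (B : Set Ω) ⊆ F := fun w hw => hEF (hBE hw)
  have hinj : Function.Injective (algebraMap B Ω) := Subtype.val_injective
  have hfZ : f.coeffs ⊆ Z'' := fun w hw => by simp [Z'', hw]
  have hgZ : g.coeffs ⊆ Z'' := fun w hw => by simp [Z'', hw]
  have hhZ : h.coeffs ⊆ Z'' := fun w hw => by simp [Z'', hw]
  have hp₂Z : p₂.coeffs ⊆ Z'' := fun w hw => by simp [Z'', hw]
  have hcoefB : ∀ P : Polynomial Ω, P.coeffs ⊆ Z'' → ∀ k, P.coeff k ∈ B := by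
    intro P hP k
    by_cases h0 : P.coeff k = 0
    exacts [h0 ▸ B.zero_mem, hZ''B _ (hP (Polynomial.coeff_mem_coeffs h0))]
  obtain ⟨fB, hfB, hfBmon'⟩ := exists_map_eq_of_coeff_mem B f (hcoefB f hfZ)
  have hfBmon : fB.Monic := hfBmon' hfmon
  obtain ⟨gB, hgB, -⟩ := exists_map_eq_of_coeff_mem B g (hcoefB g hgZ)
  obtain ⟨hB, hhB, -⟩ := exists_map_eq_of_coeff_mem B h (hcoefB h hhZ)
  obtain ⟨p₂B, hp₂B, -⟩ := exists_map_eq_of_coeff_mem B p₂ (hcoefB p₂ hp₂Z)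
  have hidentB : Polynomial.derivative fB * hB + fB * p₂B = gB ^ s := by
    apply Polynomial.map_injective (algebraMap B Ω) hinj
    simp only [Polynomial.map_mul, Polynomial.map_add, Polynomial.map_pow,
      ← Polynomial.derivative_map, hfB, hgB, hhB, hp₂B]
    exact hident
  have hfBη : Polynomial.aeval η fB = 0 := by rw [aeval_eq_eval_map, hfB]; exact hfη
  have hgBη : Polynomial.aeval η gB = g.eval η := by rw [aeval_eq_eval_map, hgB]
  have hvgB : V.valuation (Polynomial.aeval η gB) = 1 := by rw [hgBη]; exact hvg
  have hfBmin : ∀ q : Polynomial B, q ≠ 0 → Polynomial.aeval η q = 0 →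
      fB.natDegree ≤ q.natDegree := by
    intro q hq0 hq'
    have hqE : ∀ k, (q.map (algebraMap B Ω)).coeff k ∈ E := fun k => by
      rw [Polynomial.coeff_map]; exact hBE (q.coeff k).2
    have hq'0 : q.map (algebraMap B Ω) ≠ 0 := (Polynomial.map_ne_zero_iff hinj).mpr hq0
    have hev : (q.map (algebraMap B Ω)).eval η = 0 := by rw [← aeval_eq_eval_map]; exact hq'
    have h1 := hfmin _ hqE hq'0 hev
    rwa [Polynomial.natDegree_map_eq_of_injective hinj, ← hfB,
      Polynomial.natDegree_map_eq_of_injective hinj] at h1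
  obtain ⟨C, hCV, hCF, hfpC, -, hfpBC, hfuC, hpolyC, hnfC⟩ := exists_standardEtale_model_unramified V B hBV hBF
    hηV hηF fB gB hB p₂B s hfBmon hfBη hfBmin hidentB hvgB
  have hBC : ∀ b : Ω, b ∈ B → b ∈ C := fun b hb => by simpa using hpolyC (Polynomial.C ⟨b, hb⟩)
  have hηC : η ∈ C := by simpa using hpolyC Polynomial.X
  have hgC : g.eval η ∈ C := by rw [← hgBη]; exact hpolyC gB
  have hevalC : ∀ P : Polynomial Ω, P.coeffs ⊆ Z'' → P.eval η ∈ C := by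
    intro P hP
    obtain ⟨PB, hPB, -⟩ := exists_map_eq_of_coeff_mem B P (hcoefB P hP)
    rw [← hPB, ← aeval_eq_eval_map]; exact hpolyC PB
  let dz : Z → Ω := fun z => if (z : Ω) ≠ 0 then (bz z).eval η * (bz' z).eval η else 1
  have hdz : ∀ z : Z, dz z ∈ C ∧ V.valuation (dz z) = 1 := by
    intro z
    by_cases hz0 : (z : Ω) ≠ 0
    · obtain ⟨hc, hvb, -, hvb', -⟩ := hrepz z hz0
      simp only [dz, if_pos hz0]
      refine ⟨mul_mem (hevalC _ fun w hw => ?_) (hevalC _ fun w hw => ?_), by rw [map_mul, hvb, hvb', one_mul]⟩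
      · simp only [Z'', Finset.mem_union, Finset.mem_biUnion, Finset.mem_filter, Finset.mem_univ, true_and]
        exact Or.inr ⟨z, hz0, Or.inl (Or.inl (Or.inr hw))⟩
      · simp only [Z'', Finset.mem_union, Finset.mem_biUnion, Finset.mem_filter, Finset.mem_univ, true_and]
        exact Or.inr ⟨z, hz0, Or.inr hw⟩
    · simp only [dz, if_neg hz0]; exact ⟨C.one_mem, map_one _⟩
  let e : Ω := g.eval η * ∏ z ∈ Finset.univ, dz z
  have heC : e ∈ C := mul_mem hgC (prod_mem fun z _ => (hdz z).1)
  have hve : V.valuation e = 1 := by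
    simp only [e, map_mul, map_prod, hvg, one_mul]; exact Finset.prod_eq_one fun z _ => (hdz z).2
  have he0 : e ≠ 0 := fun h0 => by rw [h0, map_zero] at hve; exact zero_ne_one hve
  let C' : Subalgebra K Ω := C.restrictScalars K
  have heC' : e ∈ C' := heC
  let A : Subalgebra K Ω := locAway C' e heC'
  have hCA : ∀ w : Ω, w ∈ C → w ∈ A := fun w hw => (le_locAway : C' ≤ A) hw
  have hAV : A.toSubring ≤ V.toSubring := locAway_le_valuationSubring (B := C') hCV hve
  have hAF : (A : Set Ω) ⊆ F := locAway_subset_subfield (B := C') hCF he0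
  have hmemA : ∀ w : Ω, w ∈ A ↔ ∃ c ∈ C, ∃ n : ℕ, w = c / e ^ n := fun w =>
    mem_locAway_iff_exists_div (B := C') he0
  have hinvA : ∀ w : Ω, w ∈ C → (∃ w' ∈ C, w * w' = e) → w⁻¹ ∈ A := by
    rintro w hw ⟨w', hw', hww'⟩
    have hw0 : w ≠ 0 := fun h0 => he0 (by rw [← hww', h0, zero_mul])
    exact (hmemA _).mpr ⟨w', hw', 1, by rw [pow_one, eq_div_iff he0, ← hww', inv_mul_cancel_left₀ hw0]⟩
  have hgA : (g.eval η)⁻¹ ∈ A :=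
    hinvA _ hgC ⟨∏ z ∈ Finset.univ, dz z, prod_mem fun z _ => (hdz z).1, rfl⟩
  have hbA : ∀ z : Z, (z : Ω) ≠ 0 → ((bz z).eval η)⁻¹ ∈ A ∧ ((bz' z).eval η)⁻¹ ∈ A := by
    intro z hz0
    have hbC : (bz z).eval η ∈ C := hevalC _ fun w hw => by
      simp only [Z'', Finset.mem_union, Finset.mem_biUnion, Finset.mem_filter, Finset.mem_univ, true_and]
      exact Or.inr ⟨z, hz0, Or.inl (Or.inl (Or.inr hw))⟩
    have hb'C : (bz' z).eval η ∈ C := hevalC _ fun w hw => by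
      simp only [Z'', Finset.mem_union, Finset.mem_biUnion, Finset.mem_filter, Finset.mem_univ, true_and]
      exact Or.inr ⟨z, hz0, Or.inr hw⟩
    have hsplit : (∏ z' ∈ Finset.univ, dz z') = dz z * ∏ z' ∈ Finset.univ.erase z, dz z' :=
      (Finset.mul_prod_erase Finset.univ dz (Finset.mem_univ z)).symm
    have hdzz : dz z = (bz z).eval η * (bz' z).eval η := by simp only [dz, if_pos hz0]
    have hrest : (∏ z' ∈ Finset.univ.erase z, dz z') ∈ C := prod_mem fun z' _ => (hdz z').1
    refine ⟨hinvA _ hbC ⟨g.eval η * ((bz' z).eval η * ∏ z' ∈ Finset.univ.erase z, dz z'), mul_mem hgC (mul_mem hb'C hrest), ?_⟩,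
      hinvA _ hb'C ⟨g.eval η * ((bz z).eval η * ∏ z' ∈ Finset.univ.erase z, dz z'), mul_mem hgC (mul_mem hbC hrest), ?_⟩⟩ <;>
    · change _ = g.eval η * ∏ z' ∈ Finset.univ, dz z'
      rw [hsplit, hdzz]; ring
  have huzA : ∀ z ∈ Z, z ≠ 0 → uz z ∈ A := by
    intro z hz hz0
    obtain ⟨hc, -, heq, -, -⟩ := hrepz ⟨z, hz⟩ hz0
    have haC : (az ⟨z, hz⟩).eval η ∈ C := hevalC _ fun w hw => by
      simp only [Z'', Finset.mem_union, Finset.mem_biUnion, Finset.mem_filter, Finset.mem_univ, true_and]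
      exact Or.inr ⟨⟨z, hz⟩, hz0, Or.inl (Or.inl (Or.inl hw))⟩
    change uz (⟨z, hz⟩ : Z) ∈ A
    rw [heq, div_eq_mul_inv, mul_inv, ← inv_pow]
    exact mul_mem (hCA _ haC) (mul_mem (hbA ⟨z, hz⟩ hz0).1 (pow_mem hgA _))
  have hA₀A : ∀ w : Ω, w ∈ A₀ → w ∈ A := fun w hw => hCA w (hBC w (hA₀B hw))
  have hx'A : ∀ j, x' j ∈ A := fun j => hA₀A _ (Algebra.subset_adjoin (Or.inl ⟨j, rfl⟩))
  have hmonoc : ∀ z ∈ Z, ∃ c : Fin ρ → ℕ, mono (mz z) = ∏ j, x' j ^ (c j) := fun z hz => hDxmono (mz z) (Finset.mem_image_of_mem mz hz)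
  have hzeq : ∀ z ∈ Z, z = uz z * mono (mz z) := fun z _ => by simp only [uz]; rw [div_mul_cancel₀ _ (hmono0 _)]
  have hKA : ∀ u ∈ K, u ∈ A := fun u hu => A.algebraMap_mem (⟨u, hu⟩ : K)
  have hηA : η ∈ A := hCA _ hηC
  have hfracA : ∀ w ∈ F, ∃ a ∈ A, ∃ b ∈ A, w = a / b := by
    intro w hw
    have hwc : w ∈ Subfield.closure (A : Set Ω) := by
      rw [← hEηF] at hw
      refine (Subfield.closure_le.mpr ?_) hw
      rintro u (hu | rfl)
      · refine (Subfield.closure_le.mpr ?_) hu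
        rintro u (hu | ⟨i, rfl⟩ | ⟨j, rfl⟩)
        · exact Subfield.subset_closure (hKA u hu)
        · refine (Subfield.closure_le.mpr ?_) (hxx' i)
          rintro u (hu | ⟨j, rfl⟩)
          · exact Subfield.subset_closure (hKA u hu)
          · exact Subfield.subset_closure (hx'A j)
        · exact Subfield.subset_closure (hA₀A _ (Algebra.subset_adjoin (Or.inr ⟨j, rfl⟩)))
      · exact Subfield.subset_closure hηA
    obtain ⟨a, ha, b, hb, rfl⟩ := Subfield.mem_closure_iff.mp hwc
    have hcl : Subring.closure (A : Set Ω) = A.toSubring := Subring.closure_eq A.toSubring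
    rw [hcl] at ha hb
    exact ⟨a, ha, b, hb, rfl⟩
  have hBA : B ≤ A := fun w hw => hCA w (hBC w hw)
  have hCAsub : C.toSubring ≤ A.toSubring := fun w hw => hCA w hw
  letI algCA : Algebra C A := (Subring.inclusion hCAsub).toAlgebra
  haveI hlocA : IsLocalization.Away (⟨e, heC⟩ : C) A := isLocalization_locAway (B := C') he0
  letI algBA : Algebra B A := (Subalgebra.inclusion hBA).toRingHom.toAlgebra
  haveI : IsScalarTower B C A := IsScalarTower.of_algebraMap_eq fun b => rfl
  haveI : Algebra.FormallyUnramified B C := hfuC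
  have hftBC : Algebra.FiniteType B C := @Algebra.FiniteType.of_finitePresentation B C _ _ _ hfpBC
  haveI : Algebra.EssFiniteType B C := @Algebra.EssFiniteType.of_finiteType B C _ _ _ hftBC
  haveI : Algebra.FormallyUnramified C A :=
    Algebra.FormallyUnramified.of_isLocalization (Rₘ := A) (Submonoid.powers (⟨e, heC⟩ : C))
  haveI : Algebra.EssFiniteType C A :=
    Algebra.EssFiniteType.of_isLocalization (S := A) (Submonoid.powers (⟨e, heC⟩ : C))
  haveI : Algebra.FormallyUnramified B A := Algebra.FormallyUnramified.comp B C A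
  haveI : Algebra.EssFiniteType B A := Algebra.EssFiniteType.comp B C A
  haveI : Algebra.FiniteType K C := @Algebra.FiniteType.of_finitePresentation K C _ _ _ hfpC
  haveI : Algebra.FinitePresentation C A := IsLocalization.Away.finitePresentation (⟨e, heC⟩ : C)
  haveI : Algebra.FiniteType C A := @Algebra.FiniteType.of_finitePresentation C A _ _ _ inferInstance
  haveI : IsScalarTower K C A := IsScalarTower.of_algebraMap_eq fun _ => rfl
  have hftA : Algebra.FiniteType K A :=
    Algebra.FiniteType.trans (R := K) (S := C) (A := A) inferInstance inferInstance
  have hAfg : A.FG := (Subalgebra.fg_iff_finiteType A).mpr hftA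
  let q : Ideal A := centre A V hAV
  have hmemq : ∀ a : A, a ∈ q ↔ V.valuation (a : Ω) < 1 := fun a => by
    change Subring.inclusion hAV _ ∈ IsLocalRing.maximalIdeal V ↔ _
    rw [ValuationSubring.valuation_lt_one_iff]
    rfl
  have hx'B : ∀ j, x' j ∈ B := fun j => hA₀B (Algebra.subset_adjoin (Or.inl ⟨j, rfl⟩))
  let aB : Fin ρ → B := fun j => ⟨x' j, hx'B j⟩
  have haB : Ideal.span (Set.range aB) = q.under B := by
    apply le_antisymm
    · rw [Ideal.span_le]
      rintro _ ⟨j, rfl⟩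
      change algebraMap B A (aB j) ∈ q
      rw [hmemq]
      exact hx'1 j
    · intro b hb
      have hb' : algebraMap B A b ∈ q := hb
      rw [hmemq] at hb'
      change V.valuation (b : Ω) < 1 at hb'
      obtain ⟨b₀, hb₀, n, hbn⟩ := (mem_locAway_iff_exists_div hd0).mp b.2
      have hvb₀ : V.valuation b₀ < 1 := by
        have : V.valuation (b : Ω) = V.valuation b₀ := by
          rw [hbn, map_div₀, map_pow, hvd, one_pow, div_one]
        rwa [this] at hb'
      have hb₀cl : b₀ ∈ Subring.closure ((K : Set Ω) ∪ (Set.range x' ∪ Set.range y)) := by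
        rw [← hA₀cl]; exact hb₀
      obtain ⟨Q, hQ⟩ := (valuation_lt_one_iff_exists_sum V K hKV' x' y hx'0 hx'1 hx'i hy hri hb₀cl).mp hvb₀
      have hQA₀ : ∀ i, (MvPolynomial.eval₂Hom (MvPolynomial.aeval y).toRingHom x' (Q i) : Ω) ∈ A₀ := fun i => by
        change _ ∈ A₀.toSubring
        rw [hA₀cl]
        exact eval₂Hom_mem_closure K x' y (Q i)
      let cB : Fin ρ → B := fun i => ⟨MvPolynomial.eval₂Hom (MvPolynomial.aeval y).toRingHom x' (Q i) / d ^ n,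
        (mem_locAway_iff_exists_div hd0).mpr ⟨_, hQA₀ i, n, rfl⟩⟩
      refine Ideal.mem_span_range_iff_exists_fun.mpr ⟨cB, Subtype.ext ?_⟩
      rw [AddSubmonoidClass.coe_finsetSum]
      simp only [Subalgebra.coe_mul, cB, aB]
      rw [hbn, hQ, Finset.sum_div]
      exact Finset.sum_congr rfl fun i _ => by ring
  have hmax := maximalIdeal_eq_span_of_formallyUnramified (R := B) (S := A) q aB haB
  refine ⟨A, hAV, hAF, hAfg, hfracA, fun z hz => ?_, ρ, x', fun j => ⟨hx'A j, hx'0 j, hx'1 j⟩, ?_, hx'i, ?_, ?_⟩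
  · -- `Z ⊆ A`
    by_cases hz0 : z = 0
    · rw [hz0]; exact A.zero_mem
    obtain ⟨c, hc⟩ := hmonoc z hz
    rw [hzeq z hz, hc]
    exact mul_mem (huzA z hz hz0) (prod_mem fun j _ => pow_mem (hx'A j) _)
  · -- algebraic independence of `x'`
    have := hind.comp Sum.inl Sum.inl_injective
    rwa [Sum.elim_comp_inl] at this
  · -- the monomial read-off
    intro z hz hz0
    obtain ⟨c, hc⟩ := hmonoc z hz
    exact ⟨c, uz z, huzA z hz hz0, (huz z hz hz0).1, by rw [← hc]; exact hzeq z hz⟩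
  · -- the centre is generated by the `x'ⱼ`, elementwise
    intro a haA hva
    let aA : A := ⟨a, haA⟩
    have haq : aA ∈ q := (hmemq aA).mpr hva
    have h1 : algebraMap A (Localization.AtPrime q) aA ∈ IsLocalRing.maximalIdeal (Localization.AtPrime q) :=
      (IsLocalization.AtPrime.to_map_mem_maximal_iff (Localization.AtPrime q) q aA).mpr haq
    let aA' : Fin ρ → A := fun j => algebraMap B A (aB j)
    have hspan : Ideal.span (Set.range fun j => algebraMap B (Localization.AtPrime q) (aB j)) =
        (Ideal.span (Set.range aA')).map (algebraMap A (Localization.AtPrime q)) := by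
      rw [Ideal.map_span, ← Set.range_comp]
      congr 1
    rw [hmax, hspan] at h1
    obtain ⟨t, ht, htmem⟩ := (IsLocalization.algebraMap_mem_map_algebraMap_iff q.primeCompl
      (Localization.AtPrime q) (Ideal.span (Set.range aA')) aA).mp h1
    obtain ⟨cA, hcA⟩ := Ideal.mem_span_range_iff_exists_fun.mp htmem
    have hvt : V.valuation (t : Ω) = 1 := by
      have hnot : ¬ V.valuation (t : Ω) < 1 := fun hlt => ht ((hmemq t).mpr hlt)
      exact le_antisymm ((V.valuation_le_one_iff _).mpr (hAV t.2)) (not_lt.mp hnot)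
    refine ⟨t, t.2, hvt, fun j => (cA j : Ω), fun j => (cA j).2, ?_⟩
    have h2 := congrArg (fun w : A => (w : Ω)) hcA
    have h3 : (((∑ j, cA j * aA' j : A) : A) : Ω) = ∑ j, (cA j : Ω) * x' j := by
      rw [AddSubmonoidClass.coe_finsetSum]; exact Finset.sum_congr rfl fun j _ => rfl
    have h4 : (((t : A) * aA : A) : Ω) = (t : Ω) * a := rfl
    rw [← h4, ← h2, h3]

end KK05ValueBasis

end Summit.ResolutionOfSingularities.ResolutionOfSingularities.Theorems.RadicialJung.CleanModels

end
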